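import Summits.KontsevichZagierPeriods.KontsevichZagierPeriods.Theorems.SoloInformedKZPOneScale
import Summits.KontsevichZagierPeriods.KontsevichZagierPeriods.Theorems.SoloInformedAlgNormalForm
import Literature.NumberTheory.Transcendental.KZHomotopyMoves
import Literature.NumberTheory.Transcendental.SemialgebraicDerivativeProofs
import HarnessLib
import HarnessLib.Audit

/-!
# SoloInformed — the algebraic-coefficient interval sector of dimension 1 lies in the span of points and segments

Solo programme `solo-KontsevichZagierPeriods-informed`, session s112, file 14.

Kontsevich–Zagier (*Periods*, §1.1) remark that "rational" may be replaced by "algebraic" in the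
definition of a period.  For one-variable integrands this file makes the replacement INSIDE the
move calculus: let `P, Q ∈ ℚ̄[X]` (`ℚ̄ = algebraicClosure ℚ ℂ`, complex algebraic coefficients),
`u < v` real algebraic with `Q` non-vanishing at the real points of `[u, v]`, and let `r` be a
one-dimensional integral representation whose integrand on the interval `(u, v) ⊆ dom r` is
`x ↦ Re (P(x)/Q(x))` (this covers every real rational function with real algebraic coefficients and
no pole on `[u, v]`).  Then the piece `[(u,v), Re(P/Q)]` lies in `soloInformedSegSpan`
(`soloInformed_restrict_interval_mem_segSpan_alg`); hence such interval integrals satisfy the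
kernel property and the period conjecture pairwise — among themselves, with all rational
representations of dimension `≤ 1`, and with their algebraic multiples
(`soloInformed_algInterval_mem_segSpan`, `soloInformed_equivalent_algInterval`).

Proof = the piece lemma of file 9 with the algebraic normal form of file 13
(`soloInformed_exists_bakerNormalForm_alg`) in place of the rational one: rational room and centre,
translation (affine move), Newton–Leibniz for the Nash part, polar pieces = segments.

References: M. Kontsevich, D. Zagier, *Periods* (2001), §1.1–1.2; A. Baker, *Transcendental Number
Theory* (1975), Thm. 2.1 (context: the values are Baker periods `Σ βᵢ log αᵢ + β₀`).
-/

noncomputable section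

open scoped BigOperators Polynomial

namespace Summit.KontsevichZagierPeriods.KontsevichZagierPeriods.Theorems

open Set MeasureTheory
open Literature.ModelTheory.ExponentialFields
open Literature.NumberTheory.Transcendental Literature.NumberTheory.Transcendental.KZ

/-- The real function `x ↦ Re (P(x)/Q(x))` of the coordinate of `ℝ¹`, for `P, Q ∈ ℚ̄[X]`. -/
def soloInformedAlgFun (PL QL : (algebraicClosure ℚ ℂ)[X]) (y : Fin 1 → ℝ) : ℝ :=
  ((PL.map (algebraMap (algebraicClosure ℚ ℂ) ℂ)).eval ((y 0 : ℝ) : ℂ) /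
    (QL.map (algebraMap (algebraicClosure ℚ ℂ) ℂ)).eval ((y 0 : ℝ) : ℂ)).re

/-- `Re(P/Q)` is semialgebraic and continuous on a band `[u, v]` missing the zeros of `Q`. -/
theorem soloInformed_algFun_bandUV {u v : ℝ} (hu : IsAlgebraic ℚ u) (hv : IsAlgebraic ℚ v)
    (PL QL : (algebraicClosure ℚ ℂ)[X])
    (hQ : ∀ y ∈ soloInformedBandUV u v,
      (QL.map (algebraMap (algebraicClosure ℚ ℂ) ℂ)).eval ((y 0 : ℝ) : ℂ) ≠ 0) :
    IsSemialgebraicFunOn ℚ (soloInformedBandUV u v) (soloInformedAlgFun PL QL) ∧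
      ContinuousOn (soloInformedAlgFun PL QL) (soloInformedBandUV u v) := by
  have hcoef : ∀ (F : (algebraicClosure ℚ ℂ)[X]) (i : ℕ),
      IsAlgebraic ℚ ((F.map (algebraMap (algebraicClosure ℚ ℂ) ℂ)).coeff i) := fun F i => by
    rw [Polynomial.coeff_map]
    exact mem_algebraicClosure_iff.mp (F.coeff i).2
  have hs := soloInformed_isSemialgebraic_bandUV hu hv
  have hc := soloInformed_isSemialgebraicFunOn_bandUV_coord hu hv
  refine ⟨(re_im_div (soloInformed_re_im_polyEval hs _ (hcoef PL) hc)
    (soloInformed_re_im_polyEval hs _ (hcoef QL) hc) hQ).1, ?_⟩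
  have hev : ∀ F : ℂ[X], Continuous fun y : Fin 1 → ℝ => F.eval ((y 0 : ℝ) : ℂ) := fun F =>
    F.continuous.comp (Complex.continuous_ofReal.comp (continuous_apply 0))
  exact Complex.continuous_re.comp_continuousOn
    (((hev _).continuousOn).div (hev _).continuousOn hQ)

/-- The closed-band representation `[[u, v], Re(P/Q)]`. -/
def soloInformedAlgRep {u v : ℝ} (hu : IsAlgebraic ℚ u) (hv : IsAlgebraic ℚ v)
    (PL QL : (algebraicClosure ℚ ℂ)[X])
    (hQ : ∀ y ∈ soloInformedBandUV u v,
      (QL.map (algebraMap (algebraicClosure ℚ ℂ) ℂ)).eval ((y 0 : ℝ) : ℂ) ≠ 0) : IntegralRep 1 :=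
  ⟨soloInformedBandUV u v, soloInformedAlgFun PL QL, soloInformed_isSemialgebraic_bandUV hu hv,
    (soloInformed_algFun_bandUV hu hv PL QL hQ).1,
    (soloInformed_algFun_bandUV hu hv PL QL hQ).2.integrableOn_compact
      (soloInformed_isCompact_bandUV u v)⟩

/-- A rational room around a pole-free compact interval, for a complex polynomial read at real
points. -/
theorem soloInformed_exists_rat_room_cplx {Q : ℂ[X]} (hQ0 : Q ≠ 0) {u v : ℝ}
    (hne : ∀ t ∈ Icc u v, Q.eval (t : ℂ) ≠ 0) :
    ∃ a₀ b₀ : ℚ, (a₀ : ℝ) < u ∧ v < (b₀ : ℝ) ∧ ∀ t ∈ Ioo (a₀ : ℝ) b₀, Q.eval (t : ℂ) ≠ 0 := by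
  classical
  set Z : Finset ℝ := Q.roots.toFinset.image Complex.re with hZ
  have hmemZ : ∀ t : ℝ, Q.eval (t : ℂ) = 0 → t ∈ Z := fun t ht =>
    Finset.mem_image.2 ⟨(t : ℂ), Multiset.mem_toFinset.2 ((Polynomial.mem_roots hQ0).2 ht),
      Complex.ofReal_re t⟩
  set Zl := Z.filter (· < u) with hZl
  set a₁ : ℝ := if h : Zl.Nonempty then Zl.max' h else u - 1 with ha₁
  have ha₁u : a₁ < u := by
    rw [ha₁]
    split_ifs with h
    · exact (Finset.mem_filter.1 (Zl.max'_mem h)).2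
    · linarith
  have hZl_le : ∀ t ∈ Z, t < u → t ≤ a₁ := fun t ht htu => by
    have hmem : t ∈ Zl := Finset.mem_filter.2 ⟨ht, htu⟩
    rw [ha₁, dif_pos ⟨t, hmem⟩]
    exact Zl.le_max' t hmem
  set Zr := Z.filter (v < ·) with hZr
  set b₁ : ℝ := if h : Zr.Nonempty then Zr.min' h else v + 1 with hb₁
  have hvb₁ : v < b₁ := by
    rw [hb₁]
    split_ifs with h
    · exact (Finset.mem_filter.1 (Zr.min'_mem h)).2
    · linarith
  have hZr_le : ∀ t ∈ Z, v < t → b₁ ≤ t := fun t ht hvt => by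
    have hmem : t ∈ Zr := Finset.mem_filter.2 ⟨ht, hvt⟩
    rw [hb₁, dif_pos ⟨t, hmem⟩]
    exact Zr.min'_le t hmem
  obtain ⟨a₀, ha₁₀, ha₀u⟩ := exists_rat_btwn ha₁u
  obtain ⟨b₀, hvb₀, hb₀₁⟩ := exists_rat_btwn hvb₁
  refine ⟨a₀, b₀, ha₀u, hvb₀, fun t ht h0 => ?_⟩
  have htZ := hmemZ t h0
  by_cases htu : t < u
  · have := hZl_le t htZ htu
    linarith [ht.1]
  by_cases hvt : v < t
  · have := hZr_le t htZ hvt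
    linarith [ht.2]
  exact hne t ⟨not_lt.1 htu, not_lt.1 hvt⟩ h0

/-- **ALGEBRAIC PIECE LEMMA.** For `P, Q ∈ ℚ̄[X]` with `Q` pole-free on `[u, v]` (`u < v` real
algebraic) and a representation `r` of dimension `1` whose integrand on `(u, v) ⊆ dom r` is
`Re(P/Q)`, the piece `[(u, v), Re(P/Q)]` lies in the span of points and segments.
[Kontsevich–Zagier 2001, §1.1–1.2; this work] -/
theorem soloInformed_restrict_interval_mem_segSpan_alg (r : IntegralRep 1)
    (PL QL : (algebraicClosure ℚ ℂ)[X]) {u v : ℝ} (huv : u < v) (hu : IsAlgebraic ℚ u)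
    (hv : IsAlgebraic ℚ v)
    (hQ : ∀ t ∈ Icc u v, (QL.map (algebraMap (algebraicClosure ℚ ℂ) ℂ)).eval (t : ℂ) ≠ 0)
    (hI : IsSemialgebraic ℚ {w : Fin 1 → ℝ | ∀ i, u < w i ∧ w i < v})
    (hsub : {w : Fin 1 → ℝ | ∀ i, u < w i ∧ w i < v} ⊆ r.domain)
    (hpq : EqOn r.integrand (soloInformedAlgFun PL QL) {w : Fin 1 → ℝ | ∀ i, u < w i ∧ w i < v}) :
    of (r.restrict _ hI hsub) ∈ soloInformedSegSpan := by
  classical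
  have hs0 : ∀ (x : Fin 0 → ℝ) (t : ℝ), (Fin.snoc x t : Fin 1 → ℝ) 0 = t := fun _ _ => rfl
  have hl0 : ∀ z : Fin 1 → ℝ, z (Fin.last 0) = z 0 := fun _ => rfl
  set φ : (algebraicClosure ℚ ℂ) →+* ℂ := algebraMap (algebraicClosure ℚ ℂ) ℂ with hφ
  have hQm0 : QL.map φ ≠ 0 := by
    intro h
    exact hQ u ⟨le_rfl, huv.le⟩ (by rw [h, Polynomial.eval_zero])
  /- Step 1: rational room and a rational centre. -/
  obtain ⟨a₀, b₀, ha₀u, hvb₀, hQab⟩ := soloInformed_exists_rat_room_cplx hQm0 hQ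
  obtain ⟨m, hum, hmv⟩ := exists_rat_btwn huv
  have hmalg : IsAlgebraic ℚ (m : ℝ) := soloInformed_isAlgebraic_kit.1 m
  set u' : ℝ := u - m with hu'def
  set v' : ℝ := v - m with hv'def
  have hu'v' : u' < v' := by rw [hu'def, hv'def]; linarith
  have hu'alg : IsAlgebraic ℚ u' := hu.sub hmalg
  have hv'alg : IsAlgebraic ℚ v' := hv.sub hmalg
  set a : ℝ := (a₀ : ℝ) - m with hadef
  set b : ℝ := (b₀ : ℝ) - m with hbdef
  have hau' : a < u' := by rw [hadef, hu'def]; linarith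
  have hv'b : v' < b := by rw [hbdef, hv'def]; linarith
  have ha : a < 0 := by rw [hadef]; linarith
  have hb : 0 < b := by rw [hbdef]; linarith
  have hab : a < b := ha.trans hb
  have hIcc : Icc u' v' ⊆ Ioo a b := fun t ht => ⟨hau'.trans_le ht.1, ht.2.trans_lt hv'b⟩
  have hIab : IsSemialgebraic ℚ {t : Fin 1 → ℝ | t 0 ∈ Ioo a b} := by
    have h := KZ.BallPeeling.isSemialgebraic_Ioo₁ (a₀ - m) (b₀ - m)
    convert h using 3
    push_cast
    rw [hadef, hbdef]
  /- Step 2: the translated fraction and its Baker normal form. -/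
  set mL : algebraicClosure ℚ ℂ := algebraMap ℚ (algebraicClosure ℚ ℂ) m with hmL
  have hφm : φ mL = (m : ℂ) := by
    rw [hmL, hφ, ← IsScalarTower.algebraMap_apply, eq_ratCast]
  set P₂ : (algebraicClosure ℚ ℂ)[X] := PL.comp (Polynomial.X + Polynomial.C mL) with hP₂def
  set Q₂ : (algebraicClosure ℚ ℂ)[X] := QL.comp (Polynomial.X + Polynomial.C mL) with hQ₂def
  have hcomp : ∀ (F : (algebraicClosure ℚ ℂ)[X]) (t : ℝ),
      ((F.comp (Polynomial.X + Polynomial.C mL)).map φ).eval (t : ℂ) =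
        (F.map φ).eval (((t + m : ℝ)) : ℂ) := fun F t => by
    rw [Polynomial.map_comp, Polynomial.eval_comp, Polynomial.map_add, Polynomial.map_X,
      Polynomial.map_C, Polynomial.eval_add, Polynomial.eval_X, Polynomial.eval_C, hφm]
    push_cast
    rfl
  have hQ₂ : ∀ x ∈ Ioo a b, (Q₂.map φ).eval (x : ℂ) ≠ 0 := fun x hx => by
    rw [hQ₂def, hcomp]
    refine hQab _ ⟨?_, ?_⟩
    · have := hx.1; rw [hadef] at this; linarith
    · have := hx.2; rw [hbdef] at this; linarith
  obtain ⟨ρ, A, p, q, γ, δ, hρsa, hρan, hp, hq', hγ, hδ, hpos, hnf⟩ :=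
    soloInformed_exists_bakerNormalForm_alg P₂ Q₂ ha hb hIab hQ₂
  have hderρ : ∀ x ∈ Ioo a b, HasDerivAt ρ (deriv ρ x) x := fun x hx =>
    (hρan x hx).differentiableAt.hasDerivAt
  have hρ'sa : IsSemialgebraicFunOn ℚ {t : Fin 1 → ℝ | t 0 ∈ Ioo a b} (fun t => deriv ρ (t 0)) :=
    IsSemialgebraicFunOn.hasDerivAt_isSemialgebraic_holds a b ρ (deriv ρ) hab hρsa hderρ
  /- Step 3: the closed band `[[u, v], Re(P/Q)]` and the piece. -/
  have hQband : ∀ y ∈ soloInformedBandUV u v, (QL.map φ).eval ((y 0 : ℝ) : ℂ) ≠ 0 :=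
    fun y hy => hQ _ (soloInformed_mem_bandUV.1 hy)
  set Rc := soloInformedAlgRep hu hv PL QL hQband with hRc
  obtain ⟨r', hr'd, hr'i, hrel'⟩ := of_sub_of_restrict_openBand_mem_relations (N := 0)
    (soloInformed_isSemialgebraicFunOn_const_base hu) (soloInformed_isSemialgebraicFunOn_const_base hv)
    Rc rfl
  have hpiece : of (r.restrict _ hI hsub) - of r' ∈ relations := by
    refine of_sub_of_mem_relations_of_eqOn ?_ fun z hz => ?_
    · rw [hr'd, IntegralRep.domain_restrict]
      ext z
      simp only [mem_setOf_eq, mem_univ, true_and, Fin.forall_fin_one]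
      rfl
    · rw [IntegralRep.domain_restrict] at hz
      rw [IntegralRep.integrand_restrict, hpq hz, hr'i, hRc]
      rfl
  /- Step 4: translation to `[[u', v'], Re(P₂/Q₂)]`. -/
  have hQ₂band : ∀ y ∈ soloInformedBandUV u' v', (Q₂.map φ).eval ((y 0 : ℝ) : ℂ) ≠ 0 :=
    fun y hy => hQ₂ _ (hIcc (soloInformed_mem_bandUV.1 hy))
  set Rt := soloInformedAlgRep hu'alg hv'alg P₂ Q₂ hQ₂band with hRt
  have htrans : of Rt - of Rc ∈ relations := by
    refine of_sub_of_mem_relations_of_affine (m := 0) (G := (univ : Set (Fin 0 → ℝ))) isOpen_univ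
      (α := fun _ => (m : ℝ)) (β := fun _ => (1 : ℝ)) (a := fun _ => u') (b := fun _ => v')
      (a' := fun _ => u) (b' := fun _ => v)
      (soloInformed_isSemialgebraicFunOn_const_base hmalg)
      (soloInformed_isSemialgebraicFunOn_const_base isAlgebraic_one)
      (differentiableOn_const _) (differentiableOn_const _) (fun _ _ => one_pos)
      Rt Rc rfl rfl (fun _ _ => by rw [hu'def]; ring) (fun _ _ => by rw [hv'def]; ring)
      fun z _ => ?_
    rw [hRt, hRc]
    show soloInformedAlgFun P₂ Q₂ z =
      soloInformedAlgFun PL QL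
        (Fin.snoc (Fin.init z) ((m : ℝ) + 1 * z (Fin.last 0)) : Fin 1 → ℝ) * 1
    have hzm : ((((m : ℝ) + 1 * z (Fin.last 0) : ℝ)) : ℂ) = (((z 0 + m : ℝ)) : ℂ) := by
      rw [hl0 z]; push_cast; ring
    unfold soloInformedAlgFun
    rw [hs0, mul_one, hzm, hP₂def, hQ₂def, hcomp, hcomp]
  /- Step 5: the exact part by Newton–Leibniz. -/
  have hbandsub : soloInformedBandUV u' v' ⊆ {t : Fin 1 → ℝ | t 0 ∈ Ioo a b} := fun z hz =>
    hIcc (soloInformed_mem_bandUV.1 hz)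
  have hbandsa := soloInformed_isSemialgebraic_bandUV hu'alg hv'alg
  have hρcont : ContinuousOn ρ (Icc u' v') := fun t ht =>
    (hρan t (hIcc ht)).continuousAt.continuousWithinAt
  have hρ'cont : ContinuousOn (deriv ρ) (Icc u' v') := fun t ht =>
    (hρan t (hIcc ht)).deriv.continuousAt.continuousWithinAt
  have hcontf : ContinuousOn (fun z : Fin 1 → ℝ => deriv ρ (z 0)) (soloInformedBandUV u' v') :=
    hρ'cont.comp (continuous_apply 0).continuousOn fun z hz => soloInformed_mem_bandUV.1 hz
  have halgρ : IsAlgebraic ℚ (ρ v' - ρ u') :=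
    (hρsa.isAlgebraic_apply_one (hIcc ⟨hu'v'.le, le_rfl⟩) hv'alg).sub
      (hρsa.isAlgebraic_apply_one (hIcc ⟨le_rfl, hu'v'.le⟩) hu'alg)
  obtain ⟨rb, rd, hrbd, hrbi, hrdd, hrdi, hNL⟩ := exists_band_newtonLeibniz (N := 0)
    isSemialgebraic_univ (fun _ => u') (fun _ => v')
    (soloInformed_isSemialgebraicFunOn_const_base hu'alg)
    (soloInformed_isSemialgebraicFunOn_const_base hv'alg) (fun _ _ => hu'v'.le)
    (fun z => ρ (z 0)) (fun z => deriv ρ (z 0)) (hρsa.mono hbandsub hbandsa)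
    (hρ'sa.mono hbandsub hbandsa)
    (fun x _ => by
      show ContinuousOn (fun t : ℝ => ρ t) (Icc u' v')
      exact hρcont)
    (fun x _ t ht => by
      show HasDerivAt (fun t : ℝ => ρ t) (deriv ρ t) t
      exact hderρ t (hIcc (Ioo_subset_Icc_self ht)))
    (hcontf.integrableOn_compact (soloInformed_isCompact_bandUV u' v'))
    (by
      show IsSemialgebraicFunOn ℚ (univ : Set (Fin 0 → ℝ)) (fun _ => ρ v' - ρ u')
      exact soloInformed_isSemialgebraicFunOn_const_base halgρ)
    (by
      show IntegrableOn (fun _ : Fin 0 → ℝ => ρ v' - ρ u') univ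
      exact integrableOn_const (hs := by rw [volume_pi, Measure.pi_univ]; simp))
  have hpt : of rd - of (soloInformedPtRep (ρ v' - ρ u') halgρ) ∈ relations := by
    refine of_sub_of_mem_relations_of_eqOn (by rw [soloInformed_ptRep_domain, hrdd]) fun x _ => ?_
    rw [hrdi, soloInformed_ptRep_integrand]
    show ρ _ - ρ _ = ρ v' - ρ u'
    rw [hs0, hs0]
  /- Step 6: the polar parts are segments. -/
  set Gc : Fin A → ℂ := fun k => (γ k : ℂ) + (δ k : ℂ) * Complex.I with hGc
  set νc : Fin A → ℂ := fun k => (p k : ℂ) + (q k : ℂ) * Complex.I with hνc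
  have hGalg : ∀ k, IsAlgebraic ℚ (Gc k) := fun k =>
    soloInformed_isAlgebraic_kit.2.2 _ _ (hγ k) (hδ k)
  have hνalg : ∀ k, IsAlgebraic ℚ (νc k) := fun k =>
    soloInformed_isAlgebraic_kit.2.2 _ _ (hp k) (hq' k)
  have hνne : ∀ k, ∀ t ∈ Icc u' v', 1 - νc k * (t : ℂ) ≠ 0 := fun k =>
    soloInformed_one_sub_mul_ne_zero_of_band (hpos k) hIcc
  have hνne' : ∀ k, ∀ y ∈ soloInformedBandUV u' v', 1 - νc k * ((y 0 : ℝ) : ℂ) ≠ 0 :=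
    fun k y hy => hνne k _ (soloInformed_mem_bandUV.1 hy)
  set Rk : Fin A → IntegralRep 1 := fun k =>
    soloInformedPolRep (hGalg k) (hνalg k) hu'alg hv'alg (hνne' k) with hRk
  have hseg : ∀ k, SoloInformedSegAdm (Gc k) ((1 - νc k * (v' : ℂ)) / (1 - νc k * (u' : ℂ))) ∧
      of (soloInformedSegRep (Gc k) ((1 - νc k * (v' : ℂ)) / (1 - νc k * (u' : ℂ)))) - of (Rk k) ∈
        relations := fun k =>
    soloInformed_segRep_sub_polRep_mem_relations (hGalg k) (hνalg k) hu'alg hv'alg hu'v' (hνne k)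
      (Rk k) rfl fun _ _ => rfl
  /- Step 7: splitting the integrand of `[[u', v'], Re(P₂/Q₂)]`. -/
  have hsplit : of Rt - of rb - ∑ k, of (Rk k) ∈ relations := by
    refine of_sub_of_sub_sum_mem_relations A Rt rb Rk hrbd (fun k => rfl) fun z hz => ?_
    have hz' : z 0 ∈ Ioo a b := hbandsub hz
    rw [hrbi, hRt]
    show soloInformedAlgFun P₂ Q₂ z = deriv ρ (z 0) + ∑ k, soloInformedPolFun (Gc k) (νc k) z
    unfold soloInformedAlgFun
    rw [hnf _ hz']
    congr 1
    exact Finset.sum_congr rfl fun k _ => (soloInformed_polFun_apply_eq (γ k) (δ k) (p k) (q k) z).symm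
  /- Step 8: assembling the membership. -/
  have hRk_mem : ∀ k, of (Rk k) ∈ soloInformedSegSpan := fun k =>
    soloInformed_mem_segSpan_of_sub_mem (by simpa using relations.neg_mem (hseg k).2)
      (soloInformed_segRep_mem_segSpan (hseg k).1)
  have hrd_mem : of rd ∈ soloInformedSegSpan :=
    soloInformed_mem_segSpan_of_sub_mem hpt (soloInformed_ptRep_mem_segSpan _ halgρ)
  have hrb_mem : of rb ∈ soloInformedSegSpan := soloInformed_mem_segSpan_of_sub_mem hNL hrd_mem
  have hRt_mem : of Rt ∈ soloInformedSegSpan := by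
    refine soloInformed_mem_segSpan_of_sub_mem (y := of rb + ∑ k, of (Rk k)) ?_
      (soloInformedSegSpan.add_mem hrb_mem (soloInformed_sum_mem_segSpan _ fun k _ => hRk_mem k))
    simpa [sub_sub] using hsplit
  have hRc_mem : of Rc ∈ soloInformedSegSpan :=
    soloInformed_mem_segSpan_of_sub_mem (by simpa using relations.neg_mem htrans) hRt_mem
  have hr'_mem : of r' ∈ soloInformedSegSpan :=
    soloInformed_mem_segSpan_of_sub_mem (by simpa using relations.neg_mem hrel') hRc_mem
  exact soloInformed_mem_segSpan_of_sub_mem hpiece hr'_mem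

/-- **The algebraic-coefficient interval sector lies in the span**: a representation of dimension
`1` whose domain is an interval `(u, v)` (`u < v` real algebraic) and whose integrand is
`Re(P/Q)`, `P, Q ∈ ℚ̄[X]`, `Q` pole-free on `[u, v]`, lies in `soloInformedSegSpan`.
[Kontsevich–Zagier 2001, §1.1; this work] -/
theorem soloInformed_algInterval_mem_segSpan (r : IntegralRep 1)
    (PL QL : (algebraicClosure ℚ ℂ)[X]) {u v : ℝ} (huv : u < v) (hu : IsAlgebraic ℚ u)
    (hv : IsAlgebraic ℚ v)
    (hQ : ∀ t ∈ Icc u v, (QL.map (algebraMap (algebraicClosure ℚ ℂ) ℂ)).eval (t : ℂ) ≠ 0)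
    (hdom : r.domain = {w : Fin 1 → ℝ | ∀ i, u < w i ∧ w i < v})
    (hpq : EqOn r.integrand (soloInformedAlgFun PL QL) r.domain) :
    of r ∈ soloInformedSegSpan := by
  have hI : IsSemialgebraic ℚ {w : Fin 1 → ℝ | ∀ i, u < w i ∧ w i < v} :=
    hdom ▸ r.isSemialgebraic_domain
  have hsub : {w : Fin 1 → ℝ | ∀ i, u < w i ∧ w i < v} ⊆ r.domain := hdom ▸ subset_rfl
  refine soloInformed_mem_segSpan_of_sub_mem ?_
    (soloInformed_restrict_interval_mem_segSpan_alg r PL QL huv hu hv hQ hI hsub (hdom ▸ hpq))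
  exact of_sub_of_mem_relations_of_eqOn (by rw [IntegralRep.domain_restrict, hdom])
    fun z _ => by rw [IntegralRep.integrand_restrict]

/-- **The period conjecture, pairwise, for the algebraic-coefficient interval sector against the
whole span**: such a representation and ANY representation in `soloInformedSegSpan` (rational of
dimension `≤ 1`, scaled rational, another algebraic interval integral, …) with the same value are
KZ-equivalent; and finite `ℤ`-combinations with vanishing value are relations. [this work] -/
theorem soloInformed_equivalent_algInterval {m : ℕ} (r : IntegralRep 1) (r₀ : IntegralRep m)
    (PL QL : (algebraicClosure ℚ ℂ)[X]) {u v : ℝ} (huv : u < v) (hu : IsAlgebraic ℚ u)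
    (hv : IsAlgebraic ℚ v)
    (hQ : ∀ t ∈ Icc u v, (QL.map (algebraMap (algebraicClosure ℚ ℂ) ℂ)).eval (t : ℂ) ≠ 0)
    (hdom : r.domain = {w : Fin 1 → ℝ | ∀ i, u < w i ∧ w i < v})
    (hpq : EqOn r.integrand (soloInformedAlgFun PL QL) r.domain)
    (hr₀ : of r₀ ∈ soloInformedSegSpan) :
    (r.value = r₀.value → Equivalent r r₀) ∧
      (of r - of r₀ ∈ relations ↔ r.value = r₀.value) := by
  have hr := soloInformed_algInterval_mem_segSpan r PL QL huv hu hv hQ hdom hpq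
  refine ⟨fun hval => soloInformed_equivalent_of_mem_segSpan hr hr₀ hval, ?_, fun hval => ?_⟩
  · intro h
    have h0 : eval (of r - of r₀) = 0 := relations_le_ker_eval_holds h
    rw [map_sub, eval_of, eval_of] at h0
    exact sub_eq_zero.1 h0
  · exact soloInformed_mem_relations_of_mem_segSpan (sub_mem hr hr₀)
      (by rw [map_sub, eval_of, eval_of, hval, sub_self])

end Summit.KontsevichZagierPeriods.KontsevichZagierPeriods.Theorems
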